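import Summits.AnomalousDissipation.AnomalousDissipation.Theorems.SolenoidalFractalHomogenisationLagrangianStepSidebandXEnergyExplicit
import HarnessLib

/-!
# K1L_D `LagrangianRenormalisationStepDesign` (stmt-AnomalousDissipation-27980), `stub_D1_V0R` (ruling D27-1), brick T4c-3d″/T4d″: THE RESIDUAL
# ENERGY INEQUALITY WITH SPLIT CONSTANTS — `φ ≤ −(π²lo/2)‖r‖² + E_y·ξ²‖y‖² + E_x·ξ⁴‖x‖² + E_z·ξ⁴‖Z‖² + (2/lo)·τ`
# (helper; `--kind proof --supports stmt-AnomalousDissipation-27980 --as helper`)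

Summits-side helper file of route `SolenoidalFractalHomogenisation` (prover seat `ad-k1l-cellLawV-w1` g7; 0 sorry, no defs, no named facts).
Finding F-w1g7-2(a): the single merged constant `energyConst ~ 1/ν³` of `…SidebandXEnergyExplicit` multiplying `ξ²‖y‖²` loses the `ν`-uniformity
of the residual (`‖r‖ ~ (ξ/ν)²·M/ν`).  The bookkeeping of `…SidebandXEnergy.defect_bookkeeping` in fact proves the SPLIT form, with
`E_y = 32π²534²(hi+β/2)²/lo + 24·CL²/(π²lo)` (`~1/ν`), `E_x = (6C₂² + 12(CN·4π²(hi+β/2))²)/(π²lo)` (`~1/ν`), `E_z = 12(CN·Cf)²/(π²lo)` (`~1/ν³`, but it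
multiplies `ξ⁴‖Z‖²` only) and `2/lo` on the tail; with `‖y‖ ≤ ξ·CN·‖x‖` this gives `‖r‖ ≲ ((ξ/ν)² + (ξ/ν)³ + ξ²/ν)·M`, uniform in `ν` at fixed `ξ/ν`.
* `defect_bookkeeping_split` (abstract reals), **`residualX_energy_ineq_split`**, `elim_box_bookkeeping_split`,
  **`residualX_norm_sq_le_split`** (Grönwall from `0`, rate `π²lo/4`, tail kept as a function of time).
NOT a proof of any registered stub, of K1L_D, or of anomalous dissipation; rung F-D1.A0 infrastructure.
-/

set_option linter.dupNamespace false

noncomputable section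

namespace Summit.AnomalousDissipation.AnomalousDissipation.Theorems.SolenoidalFractalHomogenisation.LagrangianStep.Sideband

open Set MeasureTheory Complex UnitAddTorus Filter Topology intervalIntegral
open scoped InnerProductSpace
open Literature.Analysis Literature.Analysis.FunctionSpaces Literature.Analysis.FunctionSpaces.Torus
open Literature.Analysis.FluidPDE Literature.Analysis.FluidPDE.Torus Literature.Analysis.FluidPDE.LatticeShear
open Summit.AnomalousDissipation.AnomalousDissipation.Theorems.SolenoidalFractalHomogenisation.LagrangianStep.CellChain
  (modeRep kdot_modeRep continuousOn_modeRep norm_transversalProj_le)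

variable {k₀ : ℕ}

/-! ## §1 The scalar bookkeeping, split form -/

/-- **Bookkeeping of the defect pairings, SPLIT CONSTANTS** (the intermediate inequality of `defect_bookkeeping`): from the brick outputs,
`φ ≤ −(π²lo/2)N² + (Cv + 24CL²/(π²lo))·ξ²Y² + ((6C₂² + 12(CN·K₄)²)/(π²lo))·ξ⁴X² + (12(CN·Cf)²/(π²lo))·ξ⁴Zn² + (2/lo)·τ`.
[cite: MajdaKramer1999, §2.2.1.3 (cell problem (49))] -/
theorem defect_bookkeeping_split {φ P P₁ P₄ S N Y X Zn Xd τ ξ lo hi β CL C₂ CN Cf d₂ d₃ : ℝ} {n : ℕ} (hn : n ≠ 0)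
    (hlo : 0 < lo) (hhi : 0 ≤ hi) (hβ : 0 ≤ β) (hξ : 0 ≤ ξ) (hξ1 : ξ ≤ 1) (hCN : 0 ≤ CN)
    (hA : φ ≤ -(8 * Real.pi ^ 2 * (1 / (n : ℝ) ^ 2 * lo)) * S + P)
    (hB : P ≤ P₁ + 2 * (N * d₂) + 2 * (N * d₃) + P₄)
    (hC : P₁ ≤ (1 / 4) * (8 * Real.pi ^ 2 * (lo / (n : ℝ) ^ 2) * S) +
        (32 * Real.pi ^ 2 * 534 ^ 2 * (hi + β / 2) ^ 2 / lo) * ξ ^ 2 * Y ^ 2 + 4 * CL * ξ * (N * Y))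
    (hD : P₄ ≤ (1 / 4) * (8 * Real.pi ^ 2 * (lo / (n : ℝ) ^ 2) * S) + (2 / lo) * τ)
    (hS : (n : ℝ) ^ 2 / 4 * N ^ 2 ≤ S) (hd₂ : 0 ≤ d₂) (hd₃ : 0 ≤ d₃)
    (hd₂b : d₂ ≤ ξ ^ 2 * C₂ * X) (hXd : Xd ≤ 4 * Real.pi ^ 2 * (hi + β / 2) * ξ ^ 2 * X + ξ * Cf * Zn) (hd₃b : d₃ ≤ ξ * CN * Xd) :
    φ ≤ -(Real.pi ^ 2 * lo / 2) * N ^ 2 +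
      ((32 * Real.pi ^ 2 * 534 ^ 2 * (hi + β / 2) ^ 2 / lo + 24 * CL ^ 2 / (Real.pi ^ 2 * lo)) * (ξ ^ 2 * Y ^ 2) +
        (6 * C₂ ^ 2 / (Real.pi ^ 2 * lo) + 12 * (CN * (4 * Real.pi ^ 2 * (hi + β / 2))) ^ 2 / (Real.pi ^ 2 * lo)) * (ξ ^ 4 * X ^ 2) +
        12 * (CN * Cf) ^ 2 / (Real.pi ^ 2 * lo) * (ξ ^ 4 * Zn ^ 2) + 2 / lo * τ) := by
  have hn0 : (0 : ℝ) < n := by exact_mod_cast Nat.pos_of_ne_zero hn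
  set σ₀ : ℝ := Real.pi ^ 2 * lo with hσ₀
  set Cv : ℝ := 32 * Real.pi ^ 2 * 534 ^ 2 * (hi + β / 2) ^ 2 / lo with hCv
  set K₄ : ℝ := 4 * Real.pi ^ 2 * (hi + β / 2) with hK₄
  set Dis : ℝ := 8 * Real.pi ^ 2 * (lo / (n : ℝ) ^ 2) * S with hDis_def
  have hσ : 0 < σ₀ := by positivity
  have hθ : 0 < σ₀ / 6 := by positivity
  have hK₄0 : 0 ≤ K₄ := by positivity
  have hA' : φ ≤ -Dis + P := by
    have e : -(8 * Real.pi ^ 2 * (1 / (n : ℝ) ^ 2 * lo)) * S = -Dis := by rw [hDis_def]; ring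
    rw [← e]; exact hA
  have hDis : 2 * σ₀ * N ^ 2 ≤ Dis := by
    have h2 : 8 * Real.pi ^ 2 * (lo / (n : ℝ) ^ 2) * ((n : ℝ) ^ 2 / 4 * N ^ 2) = 2 * σ₀ * N ^ 2 := by
      rw [hσ₀]; field_simp; ring
    rw [← h2, hDis_def]
    exact mul_le_mul_of_nonneg_left hS (by positivity)
  have hd₃b' : d₃ ≤ ξ * CN * (K₄ * ξ ^ 2 * X + ξ * Cf * Zn) :=
    hd₃b.trans (mul_le_mul_of_nonneg_left hXd (by positivity))
  -- the three Young splits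
  have y1 : 4 * CL * ξ * (N * Y) ≤ σ₀ / 6 * N ^ 2 + (2 * CL * ξ * Y) ^ 2 / (σ₀ / 6) := by
    have h := two_mul_le_theta_sq_add (x := N) (y := 2 * CL * ξ * Y) hθ
    linarith only [h]
  have y2 : 2 * (N * d₂) ≤ σ₀ / 6 * N ^ 2 + d₂ ^ 2 / (σ₀ / 6) := two_mul_le_theta_sq_add hθ
  have y3 : 2 * (N * d₃) ≤ σ₀ / 6 * N ^ 2 + d₃ ^ 2 / (σ₀ / 6) := two_mul_le_theta_sq_add hθ
  -- sizes of the squares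
  have hξ6 : ξ ^ 6 ≤ ξ ^ 4 := pow_le_pow_of_le_one hξ hξ1 (by norm_num)
  have s2 : d₂ ^ 2 ≤ C₂ ^ 2 * (ξ ^ 4 * X ^ 2) := by
    calc d₂ ^ 2 ≤ (ξ ^ 2 * C₂ * X) ^ 2 := pow_le_pow_left₀ hd₂ hd₂b 2
      _ = C₂ ^ 2 * (ξ ^ 4 * X ^ 2) := by ring
  have s3 : d₃ ^ 2 ≤ 2 * (CN * K₄) ^ 2 * (ξ ^ 4 * X ^ 2) + 2 * (CN * Cf) ^ 2 * (ξ ^ 4 * Zn ^ 2) := by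
    have h := pow_le_pow_left₀ hd₃ hd₃b' 2
    have hab : (K₄ * ξ ^ 2 * X + ξ * Cf * Zn) ^ 2 ≤ 2 * (K₄ * ξ ^ 2 * X) ^ 2 + 2 * (ξ * Cf * Zn) ^ 2 := by
      have e : 2 * (K₄ * ξ ^ 2 * X) ^ 2 + 2 * (ξ * Cf * Zn) ^ 2 - (K₄ * ξ ^ 2 * X + ξ * Cf * Zn) ^ 2 =
          (K₄ * ξ ^ 2 * X - ξ * Cf * Zn) ^ 2 := by ring
      linarith only [sq_nonneg (K₄ * ξ ^ 2 * X - ξ * Cf * Zn), e]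
    have hexp : (ξ * CN * (K₄ * ξ ^ 2 * X + ξ * Cf * Zn)) ^ 2 ≤
        2 * (CN * K₄) ^ 2 * (ξ ^ 6 * X ^ 2) + 2 * (CN * Cf) ^ 2 * (ξ ^ 4 * Zn ^ 2) := by
      have hc : 0 ≤ (ξ * CN) ^ 2 := sq_nonneg _
      calc (ξ * CN * (K₄ * ξ ^ 2 * X + ξ * Cf * Zn)) ^ 2 = (ξ * CN) ^ 2 * (K₄ * ξ ^ 2 * X + ξ * Cf * Zn) ^ 2 := by ring
        _ ≤ (ξ * CN) ^ 2 * (2 * (K₄ * ξ ^ 2 * X) ^ 2 + 2 * (ξ * Cf * Zn) ^ 2) := mul_le_mul_of_nonneg_left hab hc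
        _ = 2 * (CN * K₄) ^ 2 * (ξ ^ 6 * X ^ 2) + 2 * (CN * Cf) ^ 2 * (ξ ^ 4 * Zn ^ 2) := by ring
    have hm : 2 * (CN * K₄) ^ 2 * (ξ ^ 6 * X ^ 2) ≤ 2 * (CN * K₄) ^ 2 * (ξ ^ 4 * X ^ 2) := by
      have : ξ ^ 6 * X ^ 2 ≤ ξ ^ 4 * X ^ 2 := mul_le_mul_of_nonneg_right hξ6 (sq_nonneg X)
      exact mul_le_mul_of_nonneg_left this (by positivity)
    linarith only [h, hexp, hm]
  have s1 : (2 * CL * ξ * Y) ^ 2 = 4 * CL ^ 2 * (ξ ^ 2 * Y ^ 2) := by ring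
  have q1 : (2 * CL * ξ * Y) ^ 2 / (σ₀ / 6) = 24 * CL ^ 2 / σ₀ * (ξ ^ 2 * Y ^ 2) := by rw [s1]; field_simp; ring
  have q2 : d₂ ^ 2 / (σ₀ / 6) ≤ 6 * C₂ ^ 2 / σ₀ * (ξ ^ 4 * X ^ 2) := by
    rw [div_le_iff₀ hθ]
    calc d₂ ^ 2 ≤ C₂ ^ 2 * (ξ ^ 4 * X ^ 2) := s2
      _ = 6 * C₂ ^ 2 / σ₀ * (ξ ^ 4 * X ^ 2) * (σ₀ / 6) := by field_simp
  have q3 : d₃ ^ 2 / (σ₀ / 6) ≤ 12 * (CN * K₄) ^ 2 / σ₀ * (ξ ^ 4 * X ^ 2) + 12 * (CN * Cf) ^ 2 / σ₀ * (ξ ^ 4 * Zn ^ 2) := by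
    rw [div_le_iff₀ hθ]
    calc d₃ ^ 2 ≤ 2 * (CN * K₄) ^ 2 * (ξ ^ 4 * X ^ 2) + 2 * (CN * Cf) ^ 2 * (ξ ^ 4 * Zn ^ 2) := s3
      _ = (12 * (CN * K₄) ^ 2 / σ₀ * (ξ ^ 4 * X ^ 2) + 12 * (CN * Cf) ^ 2 / σ₀ * (ξ ^ 4 * Zn ^ 2)) * (σ₀ / 6) := by
          field_simp; ring
  have hmain : φ ≤ -(σ₀ / 2) * N ^ 2 + ((Cv + 24 * CL ^ 2 / σ₀) * (ξ ^ 2 * Y ^ 2) +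
      (6 * C₂ ^ 2 / σ₀ + 12 * (CN * K₄) ^ 2 / σ₀) * (ξ ^ 4 * X ^ 2) + 12 * (CN * Cf) ^ 2 / σ₀ * (ξ ^ 4 * Zn ^ 2) + 2 / lo * τ) := by
    have e : (Cv + 24 * CL ^ 2 / σ₀) * (ξ ^ 2 * Y ^ 2) = Cv * ξ ^ 2 * Y ^ 2 + 24 * CL ^ 2 / σ₀ * (ξ ^ 2 * Y ^ 2) := by ring
    have e' : (6 * C₂ ^ 2 / σ₀ + 12 * (CN * K₄) ^ 2 / σ₀) * (ξ ^ 4 * X ^ 2) =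
        6 * C₂ ^ 2 / σ₀ * (ξ ^ 4 * X ^ 2) + 12 * (CN * K₄) ^ 2 / σ₀ * (ξ ^ 4 * X ^ 2) := by ring
    rw [e, e']
    linarith only [y1, y2, y3, q1, q2, q3, hDis, hA', hB, hC, hD]
  have e : -(σ₀ / 2) * N ^ 2 = -(Real.pi ^ 2 * lo / 2) * N ^ 2 := by rw [hσ₀]
  rw [e] at hmain
  exact hmain

/-! ## §2 The energy inequality of the residual, split constants -/

/-- **THE ENERGY INEQUALITY OF THE RESIDUAL, SPLIT CONSTANTS** (same bricks as `residualX_energy_ineq_explicit`): on `(0,T)`,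
`(‖r‖²)'₊ ≤ −(π²lo/2)‖r‖² + E_y·ξ²‖y‖² + E_x·ξ⁴‖x‖² + E_z·ξ⁴‖Z‖² + (2/lo)·tailEnergy`, with `E_y, E_x, E_z` as in the module docstring
(`CN = xiCN W₁ lo`, `Cf = xiCf W₁`). [cite: MajdaKramer1999, §2.2.1.3 (cell problem (49))] [cite: SandersVerhulstMurdock2007, Lemma 5.2.7 (linear case)] -/
theorem residualX_energy_ineq_split (W₁ : LatticeWord k₀) {lo hi β : ℝ} (hlo : 0 < lo) (hhi : 0 ≤ hi) (hβ : 0 ≤ β)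
    {n : ℕ} (hn : n ≠ 0) {𝔸 : Torus.Visc4 (Fin 3)} (h𝔸 : Torus.NearIso 𝔸 lo hi) (hodd : Torus.OddSmall 𝔸 β)
    {T : ℝ} {F : UnitAddTorus (Fin 3) → EuclideanSpace ℝ (Fin 3)} {w : ℝ → UnitAddTorus (Fin 3) → EuclideanSpace ℝ (Fin 3)}
    (h : Torus.IsWeakTensorPassiveVectorOn 0 T ((1 / (n : ℝ) ^ 2) • 𝔸) (W₁.cell n) F w) (hF : Integrable F volume)
    {ℓ : Fin 3 → ℤ} (hℓ : 2 * Real.sqrt (freqNormSq ℓ) ≤ n) {R : ℕ} (hbox : ∀ j, (W₁.phase j).m ∈ box R) {t : ℝ} (ht : t ∈ Ioo 0 T) :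
    ∃ φ : ℝ, HasDerivWithinAt (fun τ => ‖residualX W₁ n ℓ 𝔸 R F w τ‖ ^ 2) φ (Ici t) t ∧
      φ ≤ -(Real.pi ^ 2 * lo / 2) * ‖residualX W₁ n ℓ 𝔸 R F w t‖ ^ 2 +
        ((32 * Real.pi ^ 2 * 534 ^ 2 * (hi + β / 2) ^ 2 / lo +
            24 * (∑ j, 2 * Real.pi * ‖slotAmp W₁ j‖ * (5 + 3 * Real.sqrt (freqNormSq (W₁.phase j).m))) ^ 2 / (Real.pi ^ 2 * lo)) *
            ((Real.sqrt (freqNormSq ℓ) / n) ^ 2 * ‖refState W₁ n ℓ 𝔸 R F w t‖ ^ 2) +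
          (6 * (∑ j, 4 * Real.pi * ‖slotAmp W₁ j‖ / Real.sqrt (freqNormSq (W₁.phase j).m)) ^ 2 / (Real.pi ^ 2 * lo) +
              12 * (xiCN W₁ lo * (4 * Real.pi ^ 2 * (hi + β / 2))) ^ 2 / (Real.pi ^ 2 * lo)) *
            ((Real.sqrt (freqNormSq ℓ) / n) ^ 4 * ‖modeRep W₁ n ((1 / (n : ℝ) ^ 2) • 𝔸) F w ℓ t‖ ^ 2) +
          12 * (xiCN W₁ lo * xiCf W₁) ^ 2 / (Real.pi ^ 2 * lo) *
            ((Real.sqrt (freqNormSq ℓ) / n) ^ 4 * ‖sbVec W₁ n ((1 / (n : ℝ) ^ 2) • 𝔸) F w ℓ R t‖ ^ 2) +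
          2 / lo * tailEnergy W₁ n ℓ 𝔸 R F w t) := by
  have hCN0 : 0 ≤ xiCN W₁ lo := xiCN_nonneg W₁ hlo
  have hT : 0 < T := ht.1.trans ht.2
  have htI : t ∈ Icc 0 T := ⟨ht.1.le, ht.2.le⟩
  have hn0 : (0 : ℝ) < n := by exact_mod_cast Nat.pos_of_ne_zero hn
  have hξ0 : 0 ≤ Real.sqrt (freqNormSq ℓ) / n := by positivity
  have hξ1 : Real.sqrt (freqNormSq ℓ) / n ≤ 1 := by
    rw [div_le_one hn0]; linarith [Real.sqrt_nonneg (freqNormSq ℓ)]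
  have h𝔹 : Torus.NearIso ((1 / (n : ℝ) ^ 2) • 𝔸) (1 / (n : ℝ) ^ 2 * lo) (1 / (n : ℝ) ^ 2 * hi) := h𝔸.smul (by positivity)
  have hN : ∀ j, IsPeriodicResponse W₁ 𝔸 1 R j (response W₁ 𝔸 1 R j) := fun j => isPeriodicResponse_response_of_nearIso W₁ h𝔸 hlo one_pos R j
  have hder := hasDerivWithinAt_residual W₁ n h hF ℓ 1 hbox ht (s := Ici t)
    (fun j => hasDerivWithinAt_responseExt W₁ 𝔸 1 R j (hN j) t)
  rw [← residualX_eq, ← residualX_apply_expanded, ← refState_def] at hder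
  refine ⟨_, hasDerivWithinAt_norm_sq_of_genX W₁ n ℓ ((1 / (n : ℝ) ^ 2) • 𝔸) 1 hder, ?_⟩
  have hrT : ∀ z : box R, transversalProj (classFreq n ℓ z.1) (residualX W₁ n ℓ 𝔸 R F w t z) = residualX W₁ n ℓ 𝔸 R F w t z :=
    fun z => residual_transversal W₁ n hT.le h ℓ R htI _ z
  have hyT : ∀ z : box R, transversalProj z.1 (refState W₁ n ℓ 𝔸 R F w t z) = refState W₁ n ℓ 𝔸 R F w t z :=
    fun z => transversalProj_refState_apply W₁ ℓ h𝔸 hlo R F w t z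
  have hxT : kdot ℓ (modeRep W₁ n ((1 / (n : ℝ) ^ 2) • 𝔸) F w ℓ t) = 0 := kdot_modeRep W₁ n hT.le h ℓ htI
  have hA := two_inner_genX_add_le W₁ n ℓ h𝔹 1 t hrT
  have hC := two_real_inner_D1_le W₁ h𝔸 hlo hhi hodd hβ hn hℓ (R := R) 1 1 t hrT hyT
  have hD := sum_two_abs_re_inner_tail_le W₁ hn hℓ hlo 𝔸 R F w t (residualX W₁ n ℓ 𝔸 R F w t)
  have hS := norm_sq_le_dissipation hℓ (residualX W₁ n ℓ 𝔸 R F w t)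
  have hd₂b := norm_sum_smul_sourceX_sub_le W₁ hn ℓ R t (modeRep W₁ n ((1 / (n : ℝ) ^ 2) • 𝔸) F w ℓ t)
  have hXd := norm_slowRHS_le_xi W₁ hn ℓ h𝔸 hlo hhi hodd hβ t hxT (sbVec W₁ n ((1 / (n : ℝ) ^ 2) • 𝔸) F w ℓ R t)
  have hmain := defect_bookkeeping_split hn hlo hhi hβ hξ0 hξ1 hCN0 (hA _)
    (two_real_inner_defect_split _ _ _ _ _) hC hD hS (norm_nonneg _) (norm_nonneg _) hd₂b hXd
    (norm_projX_sum_smul_responseExt_le W₁ n ℓ h𝔸 hlo R t _)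
  unfold xiCf
  rw [xiCN_def]
  exact hmain

/-! ## §3 Elimination of the box vector and Grönwall, split constants -/

/-- Scalar step: with `Zn ≤ N + Y`, `Y ≤ ξ·CN·X`, `X ≤ M`, `2·E_z·ξ⁴ ≤ σ₀/2`:
`φ ≤ −(σ₀/2)N² + ξ⁴M²·(CN²·(E_y + 2E_z ξ²) + E_x) + (2/lo)·τ`. [cite: MajdaKramer1999, §2.2.1.3 (cell problem (49))] -/
theorem elim_box_bookkeeping_split {φ N Y X Zn τ ξ σ₀ Ey Ex Ez Ct CN M : ℝ} (hEy : 0 ≤ Ey) (hEx : 0 ≤ Ex) (hEz : 0 ≤ Ez) (hN : 0 ≤ N)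
    (hY : 0 ≤ Y) (hX : 0 ≤ X) (hZn : Zn ≤ N + Y) (hZ0 : 0 ≤ Zn) (hYX : Y ≤ ξ * CN * X) (hXM : X ≤ M) (hsmall : 2 * Ez * ξ ^ 4 ≤ σ₀ / 2)
    (hφ : φ ≤ -σ₀ * N ^ 2 + (Ey * (ξ ^ 2 * Y ^ 2) + Ex * (ξ ^ 4 * X ^ 2) + Ez * (ξ ^ 4 * Zn ^ 2) + Ct * τ)) :
    φ ≤ -(σ₀ / 2) * N ^ 2 + (ξ ^ 4 * M ^ 2 * (CN ^ 2 * (Ey + 2 * Ez * ξ ^ 2) + Ex) + Ct * τ) := by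
  have hZ2 : Zn ^ 2 ≤ 2 * N ^ 2 + 2 * Y ^ 2 := by nlinarith [sq_nonneg (N - Y)]
  have hY2 : Y ^ 2 ≤ ξ ^ 2 * CN ^ 2 * X ^ 2 := by
    calc Y ^ 2 ≤ (ξ * CN * X) ^ 2 := pow_le_pow_left₀ hY hYX 2
      _ = ξ ^ 2 * CN ^ 2 * X ^ 2 := by ring
  have hX2 : X ^ 2 ≤ M ^ 2 := pow_le_pow_left₀ hX hXM 2
  have hξ2 : 0 ≤ ξ ^ 2 := sq_nonneg _
  have hξ4 : 0 ≤ ξ ^ 4 := by positivity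
  have hCN2 : 0 ≤ CN ^ 2 := sq_nonneg _
  have hY2M : Y ^ 2 ≤ ξ ^ 2 * CN ^ 2 * M ^ 2 := hY2.trans (mul_le_mul_of_nonneg_left hX2 (by positivity))
  have h1 : Ey * (ξ ^ 2 * Y ^ 2) ≤ Ey * (ξ ^ 2 * (ξ ^ 2 * CN ^ 2 * M ^ 2)) :=
    mul_le_mul_of_nonneg_left (mul_le_mul_of_nonneg_left hY2M hξ2) hEy
  have h2 : Ex * (ξ ^ 4 * X ^ 2) ≤ Ex * (ξ ^ 4 * M ^ 2) := mul_le_mul_of_nonneg_left (mul_le_mul_of_nonneg_left hX2 hξ4) hEx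
  have h3 : Ez * (ξ ^ 4 * Zn ^ 2) ≤ Ez * (ξ ^ 4 * (2 * N ^ 2 + 2 * (ξ ^ 2 * CN ^ 2 * M ^ 2))) := by
    refine mul_le_mul_of_nonneg_left (mul_le_mul_of_nonneg_left (hZ2.trans ?_) hξ4) hEz
    linarith [hY2M]
  have h4 : Ez * (ξ ^ 4 * (2 * N ^ 2)) ≤ σ₀ / 2 * N ^ 2 := by
    have : Ez * (ξ ^ 4 * (2 * N ^ 2)) = (2 * Ez * ξ ^ 4) * N ^ 2 := by ring
    rw [this]; exact mul_le_mul_of_nonneg_right hsmall (sq_nonneg N)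
  have e1 : Ey * (ξ ^ 2 * (ξ ^ 2 * CN ^ 2 * M ^ 2)) + Ex * (ξ ^ 4 * M ^ 2) + Ez * (ξ ^ 4 * (2 * (ξ ^ 2 * CN ^ 2 * M ^ 2))) =
      ξ ^ 4 * M ^ 2 * (CN ^ 2 * (Ey + 2 * Ez * ξ ^ 2) + Ex) := by ring
  have e2 : Ez * (ξ ^ 4 * (2 * N ^ 2 + 2 * (ξ ^ 2 * CN ^ 2 * M ^ 2))) = Ez * (ξ ^ 4 * (2 * N ^ 2)) + Ez * (ξ ^ 4 * (2 * (ξ ^ 2 * CN ^ 2 * M ^ 2))) := by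
    ring
  nlinarith [hφ, h1, h2, h3, h4, e1, e2]

/-- **THE RESIDUAL NORM, SPLIT CONSTANTS**: with the a priori bound `‖x s‖ ≤ M` on `[0,T]` and `2·E_z·ξ⁴ ≤ π²lo/4` (`E_z = 12(CN·Cf)²/(π²lo)`):
for every `t ∈ [0,T]`,
`‖r t‖² ≤ e^{−(π²lo/4)t}‖r 0‖² + ∫₀ᵗ e^{−(π²lo/4)(t−s)}·(ξ⁴M²·(CN²(E_y + 2E_zξ²) + E_x) + (2/lo)·tailEnergy s) ds`.
[cite: SandersVerhulstMurdock2007, Lemma 5.2.7 (linear case)] [cite: BedrossianCotiZelati2017, §2] -/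
theorem residualX_norm_sq_le_split (W₁ : LatticeWord k₀) {lo hi β : ℝ} (hlo : 0 < lo) (hhi : 0 ≤ hi) (hβ : 0 ≤ β)
    {n : ℕ} (hn : n ≠ 0) {𝔸 : Torus.Visc4 (Fin 3)} (h𝔸 : Torus.NearIso 𝔸 lo hi) (hodd : Torus.OddSmall 𝔸 β)
    {T : ℝ} {F : UnitAddTorus (Fin 3) → EuclideanSpace ℝ (Fin 3)} {w : ℝ → UnitAddTorus (Fin 3) → EuclideanSpace ℝ (Fin 3)}
    (h : Torus.IsWeakTensorPassiveVectorOn 0 T ((1 / (n : ℝ) ^ 2) • 𝔸) (W₁.cell n) F w) (hF : Integrable F volume)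
    {ℓ : Fin 3 → ℤ} (hℓ : 2 * Real.sqrt (freqNormSq ℓ) ≤ n) {R : ℕ} (hbox : ∀ j, (W₁.phase j).m ∈ box R) {M : ℝ}
    (hM : ∀ s ∈ Icc 0 T, ‖modeRep W₁ n ((1 / (n : ℝ) ^ 2) • 𝔸) F w ℓ s‖ ≤ M)
    (hsmall : 2 * (12 * (xiCN W₁ lo * xiCf W₁) ^ 2 / (Real.pi ^ 2 * lo)) * (Real.sqrt (freqNormSq ℓ) / n) ^ 4 ≤ Real.pi ^ 2 * lo / 4)
    {t : ℝ} (ht : t ∈ Icc 0 T) :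
    ‖residualX W₁ n ℓ 𝔸 R F w t‖ ^ 2 ≤
      Real.exp (-(Real.pi ^ 2 * lo / 4 * t)) * ‖residualX W₁ n ℓ 𝔸 R F w 0‖ ^ 2 +
        ∫ s in (0:ℝ)..t, Real.exp (-(Real.pi ^ 2 * lo / 4 * (t - s))) *
          ((Real.sqrt (freqNormSq ℓ) / n) ^ 4 * M ^ 2 *
              (xiCN W₁ lo ^ 2 *
                  ((32 * Real.pi ^ 2 * 534 ^ 2 * (hi + β / 2) ^ 2 / lo +
                      24 * (∑ j, 2 * Real.pi * ‖slotAmp W₁ j‖ * (5 + 3 * Real.sqrt (freqNormSq (W₁.phase j).m))) ^ 2 / (Real.pi ^ 2 * lo)) +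
                    2 * (12 * (xiCN W₁ lo * xiCf W₁) ^ 2 / (Real.pi ^ 2 * lo)) * (Real.sqrt (freqNormSq ℓ) / n) ^ 2) +
                (6 * (∑ j, 4 * Real.pi * ‖slotAmp W₁ j‖ / Real.sqrt (freqNormSq (W₁.phase j).m)) ^ 2 / (Real.pi ^ 2 * lo) +
                  12 * (xiCN W₁ lo * (4 * Real.pi ^ 2 * (hi + β / 2))) ^ 2 / (Real.pi ^ 2 * lo))) +
            2 / lo * tailEnergy W₁ n ℓ 𝔸 R F w s) := by
  rcases le_or_gt T 0 with hT0 | hT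
  · have ht0 : t = 0 := le_antisymm (ht.2.trans hT0) ht.1
    rw [ht0, intervalIntegral.integral_same, mul_zero, neg_zero, Real.exp_zero, one_mul, add_zero]
  have hCN0 : 0 ≤ xiCN W₁ lo := xiCN_nonneg W₁ hlo
  refine le_exp_integral_of_deriv_right_le_Ioo (σ := Real.pi ^ 2 * lo / 4)
    ((((continuousOn_residualX W₁ ℓ h𝔸 hlo R hT.le h)).norm).pow 2)
    (continuousOn_const.add (continuousOn_const.mul (continuousOn_tailEnergy W₁ n ℓ 𝔸 R hT.le h))) (fun s hs => ?_) ht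
  obtain ⟨φ, hφd, hφ⟩ := residualX_energy_ineq_split W₁ hlo hhi hβ hn h𝔸 hodd h hF hℓ hbox hs
  refine ⟨φ, hφd, ?_⟩
  have hsI : s ∈ Icc 0 T := ⟨hs.1.le, hs.2.le⟩
  have hZn : ‖sbVec W₁ n ((1 / (n : ℝ) ^ 2) • 𝔸) F w ℓ R s‖ ≤ ‖residualX W₁ n ℓ 𝔸 R F w s‖ + ‖refState W₁ n ℓ 𝔸 R F w s‖ := by
    have e : sbVec W₁ n ((1 / (n : ℝ) ^ 2) • 𝔸) F w ℓ R s = residualX W₁ n ℓ 𝔸 R F w s + projX n ℓ R (refState W₁ n ℓ 𝔸 R F w s) := by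
      rw [residualX_apply, sub_add_cancel]
    rw [e]
    exact (norm_add_le _ _).trans (add_le_add le_rfl (norm_projX_le n ℓ _))
  have hYX := norm_refState_le W₁ n ℓ h𝔸 hlo R F w s
  rw [← xiCN_def] at hYX
  have hsmall' : 2 * (12 * (xiCN W₁ lo * xiCf W₁) ^ 2 / (Real.pi ^ 2 * lo)) * (Real.sqrt (freqNormSq ℓ) / n) ^ 4 ≤
      Real.pi ^ 2 * lo / 2 / 2 := by linarith
  have hEy : 0 ≤ 32 * Real.pi ^ 2 * 534 ^ 2 * (hi + β / 2) ^ 2 / lo +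
      24 * (∑ j, 2 * Real.pi * ‖slotAmp W₁ j‖ * (5 + 3 * Real.sqrt (freqNormSq (W₁.phase j).m))) ^ 2 / (Real.pi ^ 2 * lo) := by positivity
  have hEx : 0 ≤ 6 * (∑ j, 4 * Real.pi * ‖slotAmp W₁ j‖ / Real.sqrt (freqNormSq (W₁.phase j).m)) ^ 2 / (Real.pi ^ 2 * lo) +
      12 * (xiCN W₁ lo * (4 * Real.pi ^ 2 * (hi + β / 2))) ^ 2 / (Real.pi ^ 2 * lo) := by positivity
  have hEz : 0 ≤ 12 * (xiCN W₁ lo * xiCf W₁) ^ 2 / (Real.pi ^ 2 * lo) := by positivity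
  have hmain := elim_box_bookkeeping_split (σ₀ := Real.pi ^ 2 * lo / 2) hEy hEx hEz (norm_nonneg _) (norm_nonneg _) (norm_nonneg _) hZn
    (norm_nonneg _) hYX (hM s hsI) hsmall' hφ
  have e2 : -(Real.pi ^ 2 * lo / 2 / 2) * ‖residualX W₁ n ℓ 𝔸 R F w s‖ ^ 2 = -(Real.pi ^ 2 * lo / 4) * ‖residualX W₁ n ℓ 𝔸 R F w s‖ ^ 2 := by
    ring
  rw [e2] at hmain
  exact hmain

end Summit.AnomalousDissipation.AnomalousDissipation.Theorems.SolenoidalFractalHomogenisation.LagrangianStep.Sideband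

end
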